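import Literature.AnabelianGeometry.AbsoluteAnabelian.AbsTopIThm26Thm214RekeyedProofs
import Literature.AnabelianGeometry.AbsoluteAnabelian.AbsTopIAlmostProSigmaClosers
import Literature.AnabelianGeometry.AbsoluteAnabelian.AbsTopIThm26iTightness
import Literature.AnabelianGeometry.AbsoluteAnabelian.InvariantCharacterTransferProofs
import HarnessLib

/-!
# [AbsTopI] Thm 2.6 (vi) (and (i), almost pro-`Σ` form): the Weil input is EXACTLY the residual

S. Mochizuki, *Topics in Absolute Anabelian Geometry I: Generalities* (2012) [AbsTopI], Thm 2.6 (vi),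
manuscript p. 22 (lit key `paper:url-11ac98ba15fc`), proof p. 23 ll. 7–10:

  "In a similar vein, assertion (vi) follows immediately from the fact that `T_l(A)/G = 0`, together
   with the fact that `G` is very elastic [cf. Theorem 1.7, (iii)]."

Proof-only companion (no definitions, no named facts) of abc-iut-L4-t4's statement file
`AbsTopISemiAbsolute.lean` (`FundamentalExtension.Thm26vi`, `FundamentalExtension.Thm26i`) and of the
closers `NFBase.thm26vi_of_invariantCharacters_trivial` (`AbsTopIThm26Thm214RekeyedProofs.lean`:
Thm 2.6 (vi) AS TYPED from Prop 2.2 and the hypothesis `hT` = the group-theoretic content of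
"`T_l(A)/G = 0`": every `Π`-invariant continuous character `Δ → ℤ_l` is trivial — GAP-LEDGER row
G-L4t4-1 of cell abc-iut; [AbsAnab] Thm 1.1.2 is the landed `galoisNF_tfgNormalSubgroup_trivial_holds`)
and `NFBase.thm26vi_of_isAlmostPro` / `thm26i_of_isFreeProcyclic_of_isAlmostPro` (the same with `hT`
only for the primes `l ∈ Σ`, `Δ` almost pro-`Σ`).

HERE the CONVERSES are kernel-checked:
* `invariantCharacters_trivial_of_geom_le_ker` — for every extension that SPLITS OVER AN OPEN
  SUBGROUP of `G` (the standing hypothesis `SplitsOverOpenSubgroup` of [AbsAnab] §1.1, p. 7), the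
  first typed clause of Thm 2.6 (vi), "every continuous `Π → ℤ_l` kills `Δ`" (= "`Π^{ab-t} ↠ G^{ab-t}`
  is an isomorphism"), already forces `hT` at the prime `l`: a `Π`-invariant character `ψ` of `Δ`
  satisfies `ψ^{[Π : Π₁]} = Φ|_Δ` for a continuous `Φ : Π → ℤ_l` (abc-iut-L4-d3's transfer lemma
  `exists_extension_pow_index` along the splitting `Π₁ = aug⁻¹(U) → Π`, `p ↦ s(aug p)`), `Φ` kills
  `Δ`, and `ℤ_l` is torsion-free;
* hence `thm26vi_iff_of_splitsOverOpenSubgroup`: GIVEN NF base data, Prop 2.2 and the splitting,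
  `E.Thm26vi ↔ hT ↔ (clause 1 alone)`; and the almost pro-`Σ` forms `thm26vi_iff_of_isAlmostPro`,
  `thm26i_iff_of_isAlmostPro` (`hT` for `l ∈ Σ` only; for (i) no splitting hypothesis is needed,
  `G ≅ Ẑ` being projective — `AbsTopIThm26iTightness.lean`).
So the hypothesis `hT` of the dischargers is NECESSARY as well as sufficient: the residual binder of
the nodes AbsTopI:Thm2.6(i)/(vi) cannot be weakened (for (vi): at extensions with the §1.1 splitting).

Why the splitting hypothesis in (vi): without it, clause 1 only controls characters of `Δ` that
EXTEND to `Π` (`restrict_eq_one_of_geom_le_ker`, `AbsTopIThm26viProofs.lean`); the transgression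
obstruction lives in `H²(G_F, ℤ_l)`, which need not vanish for a number field `F` — unlike
`H²(Ẑ, ℤ_l) = 0` in case (i).  In the printed (geometric) situation the splitting holds as soon as
the variety has a rational point over a finite extension of the base field.

HONEST FRAMING: [AbsTopI] is a refereed, undisputed paper; nothing here bears on [IUTchIII]
Cor. 3.12; typed ≠ proved elsewhere; the Weil input `hT` stays an explicit hypothesis of the
forward directions — this file shows it cannot be weakened, it does not supply it.
-/

noncomputable section

open Topology

namespace Literature.AnabelianGeometry.AbsoluteAnabelian

universe u v

/-- `ℤ_l` is torsion-free, multiplicative form: `x ^ n = 1` with `n ≠ 0` forces `x = 1` in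
`Multiplicative ℤ_l` (`ℤ_l` is a domain of characteristic zero). [folklore] -/
private theorem eq_one_of_pow_eq_one_padicInt {l : ℕ} [Fact l.Prime] {x : Multiplicative ℤ_[l]}
    {n : ℕ} (hn : n ≠ 0) (hx : x ^ n = 1) : x = 1 := by
  have h2 : n • Multiplicative.toAdd x = 0 := by rw [← toAdd_pow, hx, toAdd_one]
  rw [nsmul_eq_mul] at h2
  rcases mul_eq_zero.mp h2 with h | h
  · exact absurd h (Nat.cast_ne_zero.mpr hn)
  · rw [← ofAdd_toAdd x, h]
    rfl

namespace FundamentalExtension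

section General

variable (E : FundamentalExtension.{u})

/-- **Invariant characters of `Δ` extend to `Π` up to a positive power, when the extension splits over
an open subgroup of `G`.**  If `s : U → Π` is a continuous section of the augmentation over an open
`U ⊆ G` ([AbsAnab] §1.1 p. 7), then `Π₁ := aug⁻¹(U)` is open, contains `Δ`, and `p ↦ s(aug p)` is a
splitting of `Π₁ ↠ Π₁/Δ`; abc-iut-L4-d3's transfer lemma `exists_extension_pow_index` then gives,
for every `Π`-invariant continuous homomorphism `ψ : Δ → A` into a commutative topological group, a
continuous `Φ : Π → A` with `Φ|_Δ = ψ^{[Π : Π₁]}`. [cite: MochizukiAbsAnab2004, Lemma 1.1.4 (ii) proof p.8] -/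
theorem exists_extension_pow_of_splitsOverOpenSubgroup (hs : E.SplitsOverOpenSubgroup)
    {A : Type v} [CommGroup A] [TopologicalSpace A] [IsTopologicalGroup A]
    (ψ : E.geom →ₜ* A)
    (hψ : ∀ (g : E.arith) (d d' : E.geom), (d' : E.arith) = g * d * g⁻¹ → ψ d' = ψ d) :
    ∃ (n : ℕ) (Φ : E.arith →ₜ* A), 0 < n ∧ ∀ d : E.geom, Φ d = ψ d ^ n := by
  classical
  obtain ⟨U, s, hU, hsec⟩ := hs
  -- `Π₁ = aug⁻¹(U)`, open and containing `Δ`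
  let P₁ : Subgroup E.arith := U.comap E.aug.toMonoidHom
  have hP₁o : IsOpen (P₁ : Set E.arith) := hU.preimage (map_continuous E.aug)
  have hP₁mem : ∀ x : E.arith, x ∈ P₁ ↔ E.aug x ∈ U := fun x => Iff.rfl
  have hDP₁ : E.geom ≤ P₁ := by
    intro x hx
    rw [hP₁mem, E.mem_geom.mp hx]
    exact U.one_mem
  -- the splitting `r = s ∘ aug : Π₁ → Π`
  let a : P₁ →* U := E.aug.toMonoidHom.subgroupComap U
  have ha : Continuous a :=
    continuous_induced_rng.2 ((map_continuous E.aug).comp continuous_subtype_val)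
  have haval : ∀ x : P₁, ((a x : U) : E.gal) = E.aug x := fun x => rfl
  let r : P₁ →ₜ* E.arith := ⟨s.toMonoidHom.comp a, s.continuous.comp ha⟩
  have hrval : ∀ x : P₁, r x = s (a x) := fun x => rfl
  have hr : ∀ p : P₁, (p : E.arith) * (r p)⁻¹ ∈ E.geom := by
    intro p
    rw [mem_geom, map_mul, map_inv, hrval, hsec, haval, mul_inv_cancel]
  have hrD : ∀ p : P₁, (p : E.arith) ∈ E.geom → r p = 1 := by
    intro p hp
    have h1 : a p = 1 := by
      apply Subtype.ext
      rw [haval]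
      simpa using E.mem_geom.mp hp
    rw [hrval, h1, map_one]
  have hψ' : ∀ (g : E.arith) (d : E.geom),
      ψ ⟨g * d * g⁻¹, E.normal_geom.conj_mem _ d.2 g⟩ = ψ d :=
    fun g d => hψ g d ⟨g * d * g⁻¹, E.normal_geom.conj_mem _ d.2 g⟩ rfl
  haveI : Finite (E.arith ⧸ P₁) := Subgroup.quotient_finite_of_isOpen P₁ hP₁o
  haveI : P₁.FiniteIndex := Subgroup.finiteIndex_of_finite_quotient
  obtain ⟨Φ, hΦ⟩ := exists_extension_pow_index E.geom P₁ hP₁o hDP₁ r hr hrD ψ hψ'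
  exact ⟨P₁.index, Φ, Nat.pos_of_ne_zero Subgroup.FiniteIndex.index_ne_zero, hΦ⟩

/-- **Clause 1 of Thm 2.6 (vi) forces the Weil input, for extensions split over an open subgroup of
`G`.**  If every continuous `φ : Π → ℤ_l` kills `Δ` ("`Π^{ab-t} ↠ G^{ab-t}` is an isomorphism",
[AbsTopI] Thm 2.6 (vi) p. 22, as typed) and the extension splits over an open subgroup of `G`, then
every `Π`-invariant continuous character `ψ : Δ → ℤ_l` is trivial: `ψ^n = Φ|_Δ = 1` with `n ≥ 1`
(`exists_extension_pow_of_splitsOverOpenSubgroup`) and `ℤ_l` is torsion-free.  This is the content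
"`T_l(A)/G = 0`" (proof p. 23) read back from the conclusion.
[cite: MochizukiAbsTopI2012, Thm 2.6 (vi) p.22] -/
theorem invariantCharacters_trivial_of_geom_le_ker (hs : E.SplitsOverOpenSubgroup)
    (l : ℕ) [Fact l.Prime]
    (h : ∀ φ : E.arith →ₜ* Multiplicative ℤ_[l], E.geom ≤ φ.toMonoidHom.ker)
    (ψ : E.geom →ₜ* Multiplicative ℤ_[l])
    (hψ : ∀ (g : E.arith) (d d' : E.geom), (d' : E.arith) = g * d * g⁻¹ → ψ d' = ψ d) :
    ∀ d, ψ d = 1 := by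
  obtain ⟨n, Φ, hn, hΦ⟩ := E.exists_extension_pow_of_splitsOverOpenSubgroup hs ψ hψ
  intro d
  have h1 : Φ d = 1 := by
    have := h Φ d.2
    rwa [MonoidHom.mem_ker] at this
  rw [hΦ] at h1
  exact eq_one_of_pow_eq_one_padicInt hn.ne' h1

/-- **Thm 2.6 (vi) AS TYPED implies the Weil input** (for extensions split over an open subgroup of
`G`): `E.Thm26vi` — through its first clause alone — gives the vanishing of all `Π`-invariant
continuous characters `Δ → ℤ_l`, all primes `l`.  Converse of the use of `hT` in
`thm26vi_of_tfgNormalSubgroup_trivial` / `NFBase.thm26vi_of_invariantCharacters_trivial`.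
[cite: MochizukiAbsTopI2012, Thm 2.6 (vi) p.22] -/
theorem invariantCharacters_trivial_of_thm26vi (hs : E.SplitsOverOpenSubgroup) (h : E.Thm26vi) :
    ∀ (l : ℕ) [Fact l.Prime] (ψ : E.geom →ₜ* Multiplicative ℤ_[l]),
      (∀ (g : E.arith) (d d' : E.geom), (d' : E.arith) = g * d * g⁻¹ → ψ d' = ψ d) →
        ∀ d, ψ d = 1 :=
  fun l _ ψ hψ => E.invariantCharacters_trivial_of_geom_le_ker hs l (h.1 l) ψ hψ

/-- **Almost pro-`Σ` form of the tightness of Thm 2.6 (i)** (no splitting hypothesis: `G ≅ Ẑ` is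
projective).  For every extension with `G ≅ Ẑ`, `Δ` almost pro-`Σ` and topologically finitely
generated (Prop 2.2), the typed Thm 2.6 (i) holds iff the Weil input holds FOR THE PRIMES `l ∈ Σ`
(for `l ∉ Σ` the `H`-invariant characters of `Δ ∩ H` vanish for free, abc-iut-w6-d071's (M1)/(M3)):
`←` is abc-iut-w6-d075's `thm26i_of_isFreeProcyclic_of_isAlmostPro`, `→` is
`invariantCharacters_trivial_of_thm26i`. [cite: MochizukiAbsTopI2012, Thm 2.6 (i) p.21] -/
theorem thm26i_iff_of_isAlmostPro (hG : IsFreeProcyclic E.gal) (S : Set ℕ)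
    (hpro : IsAlmostPro E.geom S) (hΔ : E.GeomTFG) :
    E.Thm26i ↔
      ∀ (H : Subgroup E.arith), IsOpen (H : Set E.arith) → ∀ (l : ℕ) [Fact l.Prime], l ∈ S →
        ∀ (ψ : ↥(E.geom ⊓ H) →ₜ* Multiplicative ℤ_[l]),
        (∀ g ∈ H, ∀ (d d' : ↥(E.geom ⊓ H)), (d' : E.arith) = g * d * g⁻¹ → ψ d' = ψ d) →
          ∀ d, ψ d = 1 :=
  ⟨fun h H hH l _ _ ψ hψ => E.invariantCharacters_trivial_of_thm26i hG h H hH l ψ hψ,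
    thm26i_of_isFreeProcyclic_of_isAlmostPro E hG S hpro hΔ⟩

end General

/-! ### Number-field base data: `Thm26vi ↔ hT ↔ clause 1` -/

section NF

variable (E : FundamentalExtension.{0})

/-- **TIGHTNESS of the discharge of [AbsTopI] Thm 2.6 (vi).**  For every extension
`1 → Δ → Π → G → 1` with `G ≅ G_F` (`F` a number field), `Δ` topologically finitely generated
(Prop 2.2), split over an open subgroup of `G` ([AbsAnab] §1.1), the typed Thm 2.6 (vi) is EQUIVALENT
to the Weil input `hT` ("`T_l(A)/G = 0`": every `Π`-invariant continuous character `Δ → ℤ_l` is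
trivial, every `l`) — `→` by `invariantCharacters_trivial_of_thm26vi`, `←` by
`NFBase.thm26vi_of_invariantCharacters_trivial` ([AbsAnab] Thm 1.1.2 supplied by the landed
`galoisNF_tfgNormalSubgroup_trivial_holds`).  The hypothesis `hT` (GAP-LEDGER G-L4t4-1) is thus the
exact residual content of the node at such extensions. [cite: MochizukiAbsTopI2012, Thm 2.6 (vi) p.22] -/
theorem thm26vi_iff_of_splitsOverOpenSubgroup (B : E.NFBase) (hΔ : E.GeomTFG)
    (hs : E.SplitsOverOpenSubgroup) :
    E.Thm26vi ↔
      ∀ (l : ℕ) [Fact l.Prime] (ψ : E.geom →ₜ* Multiplicative ℤ_[l]),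
        (∀ (g : E.arith) (d d' : E.geom), (d' : E.arith) = g * d * g⁻¹ → ψ d' = ψ d) →
          ∀ d, ψ d = 1 :=
  ⟨E.invariantCharacters_trivial_of_thm26vi hs, NFBase.thm26vi_of_invariantCharacters_trivial B hΔ⟩

/-- **Thm 2.6 (vi) is equivalent to its first clause** (NF base data, Prop 2.2, splitting over an
open subgroup of `G`): "`Π^{ab-t} ↠ G^{ab-t}` is an isomorphism" (every continuous `Π → ℤ_l` kills
`Δ`) already implies "`Δ` is the maximal topologically finitely generated closed normal subgroup of
`Π`" and "`Π` is not topologically finitely generated" — via the Weil input it forces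
(`invariantCharacters_trivial_of_geom_le_ker`) and [AbsAnab] Thm 1.1.2.
[cite: MochizukiAbsTopI2012, Thm 2.6 (vi) p.22] -/
theorem thm26vi_iff_clauseOne_of_splitsOverOpenSubgroup (B : E.NFBase) (hΔ : E.GeomTFG)
    (hs : E.SplitsOverOpenSubgroup) :
    E.Thm26vi ↔ ∀ (l : ℕ) [Fact l.Prime] (φ : E.arith →ₜ* Multiplicative ℤ_[l]),
      E.geom ≤ φ.toMonoidHom.ker :=
  ⟨fun h => h.1, fun h => NFBase.thm26vi_of_invariantCharacters_trivial B hΔ fun l _ ψ hψ =>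
    E.invariantCharacters_trivial_of_geom_le_ker hs l (h l) ψ hψ⟩

/-- **Almost pro-`Σ` form of the tightness of Thm 2.6 (vi).**  With NF base data, `Δ` almost
pro-`Σ` and topologically finitely generated, and the splitting over an open subgroup of `G`, the
typed Thm 2.6 (vi) holds iff the Weil input holds FOR THE PRIMES `l ∈ Σ` (`←` is abc-iut-w6-d071's
`NFBase.thm26vi_of_isAlmostPro`; for `l ∉ Σ` every continuous `Δ → ℤ_l` is trivial).
[cite: MochizukiAbsTopI2012, Thm 2.6 (vi) p.22] -/
theorem thm26vi_iff_of_isAlmostPro (B : E.NFBase) (S : Set ℕ) (hpro : IsAlmostPro E.geom S)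
    (hΔ : E.GeomTFG) (hs : E.SplitsOverOpenSubgroup) :
    E.Thm26vi ↔
      ∀ (l : ℕ) [Fact l.Prime], l ∈ S → ∀ (ψ : E.geom →ₜ* Multiplicative ℤ_[l]),
        (∀ (g : E.arith) (d d' : E.geom), (d' : E.arith) = g * d * g⁻¹ → ψ d' = ψ d) →
          ∀ d, ψ d = 1 :=
  ⟨fun h l _ _ ψ hψ => E.invariantCharacters_trivial_of_thm26vi hs h l ψ hψ,
    NFBase.thm26vi_of_isAlmostPro B S hpro hΔ⟩

end NF

end FundamentalExtension

end Literature.AnabelianGeometry.AbsoluteAnabelian
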